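import Literature.Computability.AlgebraicComplexity.FixingHoles
import Literature.Computability.AlgebraicComplexity.LaserMethodBigCW
import HarnessLib

/-!
# Complete split distributions, interface tensors, and fixing their holes
(Vassilevska Williams–Xu–Xu–Zhou 2024, Defs. 3.4–3.6, §3.7, Def. 4.1, Cor. 4.2) — definitions and proof

Topic `Literature/Computability/AlgebraicComplexity`.  The objects through which the levels of the
algorithm of Vassilevska Williams–Xu–Xu–Zhou, *New bounds for matrix multiplication: from alpha to
omega* (SODA 2024, arXiv:2307.07970) communicate, and the first theorem about them:

> **Corollary 4.2 (Fixing holes in interface tensors).** Let `𝒯` be a level-`ℓ` interface tensor with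
> parameter list `{(n_t, i_t, j_t, k_t, γ_X^{(t)}, γ_Y^{(t)}, γ_Z^{(t)})}_{t ∈ [s]}`.  Let
> `N = 2^{ℓ-1} · ∑_t n_t`.  Suppose `𝒯_1, …, 𝒯_r` are broken copies of `𝒯` where `≤ 1/(8N)` fraction
> of level-1 `X`-, `Y`- and `Z`-blocks are holes.  If `r ≥ 2^{C_1 N / log N}` for some large enough
> constant `C_1 > 0`, the direct sum `⊕_{i=1}^r 𝒯_i` can degenerate into an unbroken copy of `𝒯`.

Everything is PROVED (the corollary as `vxxz2024_cor42`, from the general fixing-holes theorem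
`vxxz2024_thm72` of `FixingHoles.lean`, of which it is printed as a corollary); the definitions are the
paper's, in the coordinates below.

## Coordinates (VXXZ §3.7–§3.10, §4.1)

* **Levels and chunks (§3.7–§3.8).**  `T^{(ℓ)} = CW_q^{⊗ 2^{ℓ-1}}`; we write `c` for the chunk length
  `2^{ℓ-1}` (nothing below uses that `c` is a power of two) and index the variables of
  `(T^{(ℓ)})^{⊗n} = CW_q^{⊗cn}` by `x : Fin n → Fin c → Fin (q+2)` (chunk `u`, position `p` inside
  the chunk): this is literally the format of `kroneckerPow (kroneckerPow (bigCwTensor K q) c) n`.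
  The *level-1 index sequence* of `x` is `levelSeq x : Fin n → Fin c → Fin 3` (`cwLevel₃` of
  `LaserMethodBigCW.lean`: `0 ↦ 0`, `1..q ↦ 1`, `q+1 ↦ 2`), its *level-`ℓ` index sequence* is the
  sequence of chunk sums `chunkLevels (levelSeq x) : Fin n → ℕ` (values in `{0,…,2c}`; "`Î ∈ I`" of
  §3.8 reads `chunkLevels Î = I`), and the **level-`ℓ` constituent tensor** `T_{i,j,k}` (§3.7) is
  `cwConstituent K q c i j k`, the zero-out of `CW_q^{⊗c}` to chunk level sums `(i, j, k)`;
  `CW_q^{⊗c} = ∑_{i+j+k = 2c} T_{i,j,k}` (`kroneckerPow_bigCw_eq_sum_cwConstituent`).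
* **Complete split distributions (Defs. 3.4–3.5).**  A complete split distribution is a function
  `γ : (Fin c → Fin 3) → ℝ` on chunk shapes `{0,1,2}^c`; `completeSplitOn I S σ = #{u ∈ S | I_u = σ}/|S|`
  is `split(Î, S)` and `completeSplit I = split(Î)` (`= letterCount Î / n`, the type of the word of
  chunks); `SplitConsistentOn ε γ I S` is "`Î|_S` is consistent with `γ` up to `ε` error"
  (`‖split(Î,S) − γ‖_∞ ≤ ε`; `ε = 0`: consistent).
* **Interface tensors (Def. 3.6, Def. 4.1).**  A parameter list
  `{(n_t, i_t, j_t, k_t, γ_X^{(t)}, γ_Y^{(t)}, γ_Z^{(t)})}_{t ∈ [s]}` is presented as a *term map*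
  `τ : Fin n → Fin s` on the `n = ∑ n_t` chunks (`n_t = |τ⁻¹(t)|`; the paper concatenates the terms,
  §7: "`σ` can be regarded as a permutation over `[n]`, indicating the destinations of all `n` chunks")
  together with `L : Fin s → InterfaceTerm c` (the data `(i_t, j_t, k_t, γ_X^{(t)}, γ_Y^{(t)}, γ_Z^{(t)})`).
  The **level-`ℓ` `ε`-interface tensor** `interfaceTensor K q τ L ε` is the zero-out of `CW_q^{⊗cn}`
  keeping the variables whose level-1 sequence lies in `levelBlocksX τ L ε` (chunk `u` in level-`ℓ`
  block `i_{τ u}`, and on every term's chunk set `τ⁻¹(t)` the complete split distribution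
  `ε`-consistent with `γ_X^{(t)}`), resp. `levelBlocksY`, `levelBlocksZ` — i.e.
  `⊗_t T_{i_t,j_t,k_t}^{⊗ n_t}[γ_X^{(t)}, γ_Y^{(t)}, γ_Z^{(t)}, ε]` of Def. 4.1 realised on the
  concatenated chunk set (`interfaceTensor_apply_prod`: its entries are
  `∏_u T_{i_{τu}, j_{τu}, k_{τu}}(x_u, y_u, z_u)` on admissible triples); one term (`s = 1`) is
  Def. 3.6's `T_{i,j,k}^{⊗N}[γ_X, γ_Y, γ_Z, ε]` (`cwSplitTerm`); a term without chunks (`n_t = 0`)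
  imposes no condition (it is the trivial factor `⟨1⟩` of the product, as in the paper); the paper's
  ranges `0 ≤ ε (≤ 1)`, `i_t + j_t + k_t = 2^ℓ` and "`γ` a distribution" are not imposed (outside them
  terms are empty or zero, see `InterfaceTerm`).  The finite sets `levelBlocksW τ L ε` ARE the level-1
  `W`-blocks of the `ε`-interface tensor, `M_W` their number.  The remark after Def. 4.1 — the tensor
  product of two `ε`-interface tensors is the `ε`-interface tensor of the concatenated parameter
  list — is `interfaceTensor_append` / `tensorRestrictsTo_kronecker_interfaceTensor_concat` /
  `tensorRestrictsTo_interfaceTensor_concat_kronecker` (term maps concatenated by `concatTermMap`).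
* **Broken copies** with holes `H_X, H_Y, H_Z` (finite sets of level-1 sequences) are the zero-outs
  `partSubtensor levelSeq levelSeq levelSeq 𝒯 H_Xᶜ H_Yᶜ H_Zᶜ` (`PartitionedTensors.lean`, VXXZ §7).

## Corollary 4.2 and its proof (§7, last page)

`vxxz2024_cor42`: for `c, n ≥ 1`, `N = c n`, broken copies `𝒯_1, …, 𝒯_r` of `𝒯 = interfaceTensor K q τ L 0`
with `8 N |H_W(i)| ≤ M_W` (hole fraction `≤ 1/(8N)`) and `r ≥ 8^{3 ⌊log_{2N} 3^N⌋ + 3}`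
(`= 2^{9 + 9⌊N log 3 / log 2N⌋} = 2^{O(N / log N)}`, the printed `2^{C_1 N/log N}`), the direct sum
`⊕_i 𝒯_i` RESTRICTS to `𝒯`.  Proof as printed: apply Thm. 7.2 (`vxxz2024_thm72`, with
`L_W = 2N`, so that its hole budget `4 L_W |H_W| ≤ M_W` is the hypothesis and `M_W ≤ 3^N` bounds its
count `8^{Σ_W ⌊log_{L_W} M_W⌋ + 3}`) to `𝒯` viewed as a partitioned tensor on its own variables
(the sub-format of admissible variables, `tensorRestrictsTo_extend_subtype` moves back) with the
level-1 blocks as parts, and with the symmetry family `𝒢 = chunkSymmetries τ` — the permutations of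
the `n` chunks preserving the term map ("randomly permute chunks within the same term"), acting on
variables and on level-1 sequences by `chunkPerm`.  Property 7.1: parts go to parts
(`levelSeq_chunkPerm`), the tensor is preserved (`interfaceTensor_chunkPerm`), and a uniformly random
element of `𝒢` maps any block to a uniformly random block (`card_filter_mul_card_eq_of_transitive`:
uniform fibres from transitivity, which holds because two admissible sequences have, term by term,
the same number of chunks of each shape, hence differ by a term-preserving chunk permutation —
`exists_chunkSymm_apply_eq`, through `exists_perm_of_letterCount_eq` applied to the word
`u ↦ (τ u, Î_u)`).

## References

* V. Vassilevska Williams, Y. Xu, Z. Xu, R. Zhou, *New bounds for matrix multiplication: from alpha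
  to omega*, SODA 2024, arXiv:2307.07970 (held: `paper:arxiv-2307.07970`): §3.7 (leveled partition,
  constituent tensors `T_{i,j,k}`), §3.8, §3.10 Defs. 3.4–3.6, §4.1 Def. 4.1 (and the remark following
  it), §4.2 Cor. 4.2 (the corollary `corfixinterface` of Thm. 7.2, cited as `cor:fix-interface` in
  §5.6/§6.6), §7 (Property 7.1, Thm. 7.2, proof of Cor. 4.2 on the last page of §7).
  [VassilevskaWilliamsXuXuZhou2024]
* R. Duan, H. Wu, R. Zhou, *Faster matrix multiplication via asymmetric hashing*, FOCS 2023,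
  arXiv:2210.10173 (split distributions — the case `c = 2` of complete split distributions — and the
  fixing of holes in the `Z`-dimension which §7 of VXXZ generalises). [DuanWuZhou2022]
-/

noncomputable section

open scoped BigOperators
open Finset

namespace Literature.Computability.AlgebraicComplexity

open Literature.Barriers.MatrixMultiplication (bigCwTensor bigCwTensor_apply)

universe u

/-! ## Level sequences of the variables of `(CW_q^{⊗c})^{⊗n}` (§3.7–§3.8) -/

section LevelSeq

variable {q c n : ℕ}

/-- **The level-1 index sequence `Î ∈ {0,1,2}^{cn}` of a variable of `(CW_q^{⊗c})^{⊗n}`**, in chunked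
form (chunk `u`, position `p`; levels `cwLevel₃`: `0 ↦ 0`, `1, …, q ↦ 1`, `q+1 ↦ 2`).
[cite: VassilevskaWilliamsXuXuZhou2024, §3.8 (level-1 index sequence)] -/
def levelSeq (x : Fin n → Fin c → Fin (q + 2)) : Fin n → Fin c → Fin 3 := fun u p => cwLevel₃ (x u p)

/-- Entries of the level-1 sequence. [cite: VassilevskaWilliamsXuXuZhou2024, §3.8] -/
@[simp] theorem levelSeq_apply (x : Fin n → Fin c → Fin (q + 2)) (u : Fin n) (p : Fin c) :
    levelSeq x u p = cwLevel₃ (x u p) := rfl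

/-- The level-`ℓ` index of a chunk shape `σ ∈ {0,1,2}^c`: the sum of its entries (`∈ {0,…,2c}`).
[cite: VassilevskaWilliamsXuXuZhou2024, §3.7 (level-ℓ partition: "sequences with the same sum are merged")] -/
def patternLevel (σ : Fin c → Fin 3) : ℕ := ∑ p, (σ p : ℕ)

/-- Level-`ℓ` indices lie in `{0, …, 2c}` (`= {0, …, 2^ℓ}`). [cite: VassilevskaWilliamsXuXuZhou2024, §3.7] -/
theorem patternLevel_le (σ : Fin c → Fin 3) : patternLevel σ ≤ 2 * c := by
  unfold patternLevel
  calc ∑ p, (σ p : ℕ) ≤ ∑ _p : Fin c, 2 := sum_le_sum fun p _ => Nat.le_of_lt_succ (σ p).isLt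
    _ = 2 * c := by simp [mul_comm]

/-- **The level-`ℓ` index sequence `I ∈ {0,…,2c}^n` of a level-1 sequence** (chunk sums; §3.8:
"`Î ∈ I`" iff taking the sums of consecutive length-`c` chunks of `Î` yields `I`). [cite: VassilevskaWilliamsXuXuZhou2024, §3.8] -/
def chunkLevels (I : Fin n → Fin c → Fin 3) : Fin n → ℕ := fun u => patternLevel (I u)

/-- Entries of the level-`ℓ` sequence. [cite: VassilevskaWilliamsXuXuZhou2024, §3.8] -/
@[simp] theorem chunkLevels_apply (I : Fin n → Fin c → Fin 3) (u : Fin n) :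
    chunkLevels I u = patternLevel (I u) := rfl

/-- The level-`ℓ` index of a chunk of a variable is the sum of the levels of its indices.
[cite: VassilevskaWilliamsXuXuZhou2024, §3.7] -/
theorem patternLevel_levelSeq (x : Fin n → Fin c → Fin (q + 2)) (u : Fin n) :
    patternLevel (levelSeq x u) = ∑ p, cwLevel (x u p) := by
  simp [patternLevel]

end LevelSeq

/-! ## Complete split distributions (Defs. 3.4–3.5) -/

section Split

variable {c n : ℕ}

/-- **`split(Î, S)`** (Def. 3.5): the complete split distribution of the level-1 sequence `Î`
restricted to the set of chunks `S ⊆ [n]` — the proportion, among the chunks in `S`, of those of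
shape `σ ∈ {0,1,2}^c`.  (A *complete split distribution*, Def. 3.4, is any distribution on the chunk
shapes `{0,1,2}^c`, here a function `(Fin c → Fin 3) → ℝ`.) [cite: VassilevskaWilliamsXuXuZhou2024, Def. 3.5] -/
def completeSplitOn (I : Fin n → Fin c → Fin 3) (S : Finset (Fin n)) (σ : Fin c → Fin 3) : ℝ :=
  ((S.filter fun u => I u = σ).card : ℝ) / S.card

/-- **`split(Î)`** (Def. 3.5): the complete split distribution of `Î` over all chunks.
[cite: VassilevskaWilliamsXuXuZhou2024, Def. 3.5] -/
def completeSplit (I : Fin n → Fin c → Fin 3) : (Fin c → Fin 3) → ℝ := completeSplitOn I univ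

/-- Unfolding of `split(Î, S)`. [cite: VassilevskaWilliamsXuXuZhou2024, Def. 3.5] -/
theorem completeSplitOn_apply (I : Fin n → Fin c → Fin 3) (S : Finset (Fin n)) (σ : Fin c → Fin 3) :
    completeSplitOn I S σ = ((S.filter fun u => I u = σ).card : ℝ) / S.card := rfl

/-- `split(Î)` is the type (empirical distribution) of the word of chunks: `letterCount Î / n`.
[cite: VassilevskaWilliamsXuXuZhou2024, Def. 3.5] -/
theorem completeSplit_apply (I : Fin n → Fin c → Fin 3) (σ : Fin c → Fin 3) :
    completeSplit I σ = (letterCount I σ : ℝ) / n := by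
  simp [completeSplit, completeSplitOn, letterCount_apply]

/-- `split(Î, S) ≥ 0`. [cite: VassilevskaWilliamsXuXuZhou2024, Def. 3.5] -/
theorem completeSplitOn_nonneg (I : Fin n → Fin c → Fin 3) (S : Finset (Fin n)) (σ : Fin c → Fin 3) :
    0 ≤ completeSplitOn I S σ := by
  unfold completeSplitOn; positivity

/-- `split(Î, S) ≤ 1`. [cite: VassilevskaWilliamsXuXuZhou2024, Def. 3.5] -/
theorem completeSplitOn_le_one (I : Fin n → Fin c → Fin 3) (S : Finset (Fin n)) (σ : Fin c → Fin 3) :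
    completeSplitOn I S σ ≤ 1 := by
  unfold completeSplitOn
  rcases Nat.eq_zero_or_pos S.card with h | h
  · simp [h]
  · rw [div_le_one (by exact_mod_cast h)]
    exact_mod_cast card_filter_le _ _

/-- `split(Î, S)` is a probability distribution on chunk shapes when `S ≠ ∅`. [cite: VassilevskaWilliamsXuXuZhou2024, Def. 3.4–3.5] -/
theorem sum_completeSplitOn (I : Fin n → Fin c → Fin 3) {S : Finset (Fin n)} (hS : S.Nonempty) :
    ∑ σ, completeSplitOn I S σ = 1 := by
  have hc : (S.card : ℝ) ≠ 0 := by exact_mod_cast hS.card_pos.ne'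
  simp only [completeSplitOn, ← Finset.sum_div]
  rw [div_eq_one_iff_eq hc]
  have h := card_eq_sum_card_fiberwise (f := I) (s := S) (t := univ) fun _ _ => mem_univ _
  exact_mod_cast h.symm

/-- **Consistency up to `ε`** (Def. 3.5, last paragraph; Def. 3.4 for `ε = 0`): `Î` restricted to the
chunks `S` is consistent with the complete split distribution `γ` up to `ε` error,
`‖split(Î, S) − γ‖_∞ ≤ ε`.  (The paper takes `ε ≥ 0`, Def. 3.6, resp. `0 ≤ ε ≤ 1`, Def. 4.1; the range
is not imposed here — for `ε < 0` nothing is consistent.) [cite: VassilevskaWilliamsXuXuZhou2024, Def. 3.5] -/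
def SplitConsistentOn (ε : ℝ) (γ : (Fin c → Fin 3) → ℝ) (I : Fin n → Fin c → Fin 3)
    (S : Finset (Fin n)) : Prop :=
  ∀ σ, |completeSplitOn I S σ - γ σ| ≤ ε

/-- Consistency with `ε = 0` is equality `split(Î, S) = γ` (Def. 3.4: "`Î` is consistent with `γ`").
[cite: VassilevskaWilliamsXuXuZhou2024, Def. 3.4] -/
theorem splitConsistentOn_zero_iff {γ : (Fin c → Fin 3) → ℝ} {I : Fin n → Fin c → Fin 3}
    {S : Finset (Fin n)} : SplitConsistentOn 0 γ I S ↔ completeSplitOn I S = γ := by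
  simp [SplitConsistentOn, abs_nonpos_iff, sub_eq_zero, funext_iff]

/-- Consistency is monotone in the tolerance. [cite: VassilevskaWilliamsXuXuZhou2024, Def. 3.5] -/
theorem SplitConsistentOn.mono {ε ε' : ℝ} {γ : (Fin c → Fin 3) → ℝ} {I : Fin n → Fin c → Fin 3}
    {S : Finset (Fin n)} (h : SplitConsistentOn ε γ I S) (hε : ε ≤ ε') : SplitConsistentOn ε' γ I S :=
  fun σ => (h σ).trans hε

end Split

/-! ## Chunk permutations (§7, proof of Cor. 4.2: "`σ'` induces a permutation `π_X` over all `X`-variables") -/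

section ChunkPerm

variable {n : ℕ} {α : Type*}

/-- A permutation `σ` of the chunks acts on chunked sequences: `(σ · x)_u = x_{σ⁻¹ u}`
(Mathlib's `Equiv.arrowCongr σ (Equiv.refl α)`).
[cite: VassilevskaWilliamsXuXuZhou2024, §7 (proof of Cor. 4.2, the permutations π_X, π_Y, π_Z)] -/
abbrev chunkPerm (σ : Equiv.Perm (Fin n)) : Equiv.Perm (Fin n → α) := Equiv.arrowCongr σ (Equiv.refl α)

/-- `(σ · x)_u = x_{σ⁻¹ u}`. [folklore] -/
@[simp] theorem chunkPerm_apply (σ : Equiv.Perm (Fin n)) (x : Fin n → α) (u : Fin n) :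
    chunkPerm σ x u = x (σ.symm u) := rfl

/-- `chunkPerm` is a homomorphism: identity. [folklore] -/
theorem chunkPerm_one : chunkPerm (1 : Equiv.Perm (Fin n)) = (1 : Equiv.Perm (Fin n → α)) := by
  ext x u
  simp [Equiv.Perm.one_def]

/-- `chunkPerm` is a homomorphism: products. [folklore] -/
theorem chunkPerm_mul (σ σ' : Equiv.Perm (Fin n)) :
    (chunkPerm (σ * σ') : Equiv.Perm (Fin n → α)) = chunkPerm σ * chunkPerm σ' := by
  ext x u
  simp [Equiv.Perm.mul_def]

/-- `chunkPerm` is a homomorphism: inverses. [folklore] -/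
theorem chunkPerm_inv (σ : Equiv.Perm (Fin n)) :
    (chunkPerm σ⁻¹ : Equiv.Perm (Fin n → α)) = (chunkPerm σ)⁻¹ := by
  ext x u
  simp [Equiv.Perm.inv_def, chunkPerm]

/-- Post-composition commutes with chunk permutations (e.g. `levelSeq (σ · x) = σ · levelSeq x`). [folklore] -/
theorem chunkPerm_postcomp {β : Type*} (f : α → β) (σ : Equiv.Perm (Fin n)) (x : Fin n → α) :
    (fun u => f (chunkPerm σ x u)) = chunkPerm σ (fun u => f (x u)) := rfl

/-- Restricted counts are invariant: if `σ` stabilises `S` then `#{u ∈ S | (σ·I)_u = a} = #{u ∈ S | I_u = a}`.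
[folklore] -/
theorem card_filter_chunkPerm_eq (σ : Equiv.Perm (Fin n)) {S : Finset (Fin n)}
    (hS : ∀ u, σ u ∈ S ↔ u ∈ S) [DecidableEq α] (I : Fin n → α) (a : α) :
    (S.filter fun u => chunkPerm σ I u = a).card = (S.filter fun u => I u = a).card := by
  refine card_bij (fun u _ => σ.symm u) (fun u hu => ?_) (fun u _ v _ h => by simpa using h)
    (fun v hv => ⟨σ v, ?_, by simp⟩)
  · rw [mem_filter] at hu ⊢
    refine ⟨?_, by simpa using hu.2⟩
    have := (hS (σ.symm u)).1 (by simpa using hu.1)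
    exact this
  · rw [mem_filter] at hv ⊢
    exact ⟨(hS v).2 hv.1, by simpa using hv.2⟩

end ChunkPerm

section SplitPerm

variable {c n : ℕ}

/-- `split(σ·Î, S) = split(Î, S)` for a permutation `σ` of the chunks stabilising `S`. [cite: VassilevskaWilliamsXuXuZhou2024, §7 (proof of Cor. 4.2: "π_X(X_Î) must also satisfy the complete split distributions")] -/
theorem completeSplitOn_chunkPerm (σ : Equiv.Perm (Fin n)) {S : Finset (Fin n)}
    (hS : ∀ u, σ u ∈ S ↔ u ∈ S) (I : Fin n → Fin c → Fin 3) :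
    completeSplitOn (chunkPerm σ I) S = completeSplitOn I S := by
  funext a
  simp only [completeSplitOn, card_filter_chunkPerm_eq σ hS I a]

/-- Consistency of `σ·Î` on `S` is consistency of `Î` on `S`, for `σ` stabilising `S`. [cite: VassilevskaWilliamsXuXuZhou2024, §7 (proof of Cor. 4.2)] -/
theorem splitConsistentOn_chunkPerm_iff (σ : Equiv.Perm (Fin n)) {S : Finset (Fin n)}
    (hS : ∀ u, σ u ∈ S ↔ u ∈ S) (ε : ℝ) (γ : (Fin c → Fin 3) → ℝ) (I : Fin n → Fin c → Fin 3) :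
    SplitConsistentOn ε γ (chunkPerm σ I) S ↔ SplitConsistentOn ε γ I S := by
  simp only [SplitConsistentOn, completeSplitOn_chunkPerm σ hS]

end SplitPerm

/-! ## Level-`ℓ` constituent tensors `T_{i,j,k}` of `T^{(ℓ)} = CW_q^{⊗c}` (§3.7) -/

section Constituent

variable (K : Type u) [CommSemiring K] (q c : ℕ)

/-- **The level-`ℓ` constituent tensor `T_{i,j,k} = T^{(ℓ)}|_{X_i, Y_j, Z_k}`** of
`T^{(ℓ)} = CW_q^{⊗c}` (`c = 2^{ℓ-1}`): the zero-out of `CW_q^{⊗c}` keeping the `X`-indices whose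
levels sum to `i`, the `Y`-indices whose levels sum to `j` and the `Z`-indices whose levels sum to
`k` (same format as `CW_q^{⊗c}`). [cite: VassilevskaWilliamsXuXuZhou2024, §3.7 (level-ℓ constituent tensor)] -/
def cwConstituent (i j k : ℕ) :
    (Fin c → Fin (q + 2)) → (Fin c → Fin (q + 2)) → (Fin c → Fin (q + 2)) → K :=
  fun x y z => if (∑ p, cwLevel (x p)) = i ∧ (∑ p, cwLevel (y p)) = j ∧ (∑ p, cwLevel (z p)) = k then
    kroneckerPow (bigCwTensor K q) c x y z else 0

/-- Entries of `T_{i,j,k}`. [cite: VassilevskaWilliamsXuXuZhou2024, §3.7] -/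
theorem cwConstituent_apply (i j k : ℕ) (x y z : Fin c → Fin (q + 2)) :
    cwConstituent K q c i j k x y z =
      if (∑ p, cwLevel (x p)) = i ∧ (∑ p, cwLevel (y p)) = j ∧ (∑ p, cwLevel (z p)) = k then
        kroneckerPow (bigCwTensor K q) c x y z else 0 := rfl

/-- The supported entries of `CW_q^{⊗c}` have total level `2c`. [cite: VassilevskaWilliamsXuXuZhou2024, §3.7 ("T_{i,j,k} is nonzero if and only if i+j+k = 2^ℓ")] -/
theorem sum_cwLevel_of_kroneckerPow_bigCw_ne_zero {x y z : Fin c → Fin (q + 2)}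
    (h : kroneckerPow (bigCwTensor K q) c x y z ≠ 0) :
    (∑ p, cwLevel (x p)) + (∑ p, cwLevel (y p)) + (∑ p, cwLevel (z p)) = 2 * c := by
  rw [kroneckerPow_apply] at h
  have hp := bigCw_block_support K x y z h
  calc (∑ p, cwLevel (x p)) + (∑ p, cwLevel (y p)) + (∑ p, cwLevel (z p))
      = ∑ p, (cwLevel (x p) + cwLevel (y p) + cwLevel (z p)) := by
        simp only [sum_add_distrib]
    _ = ∑ _p : Fin c, 2 := sum_congr rfl fun p _ => hp p
    _ = 2 * c := by simp [mul_comm]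

/-- **`T_{i,j,k} = 0` unless `i + j + k = 2c`** (§3.7: "`T^{(ℓ)}_{i,j,k}` is nonzero if and only if
`i + j + k = 2^ℓ`", the `only if`). [cite: VassilevskaWilliamsXuXuZhou2024, §3.7] -/
theorem cwConstituent_eq_zero {i j k : ℕ} (h : i + j + k ≠ 2 * c) : cwConstituent K q c i j k = 0 := by
  funext x y z
  rw [cwConstituent_apply]
  split_ifs with hx
  · by_contra hne
    obtain ⟨rfl, rfl, rfl⟩ := hx
    exact h (sum_cwLevel_of_kroneckerPow_bigCw_ne_zero K q c hne)
  · rfl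

/-- The index set of the level-`ℓ` constituent tensors: `{(i,j,k) | i, j, k ≤ 2c, i + j + k = 2c}`.
[cite: VassilevskaWilliamsXuXuZhou2024, §3.7] -/
def constituentTriples : Finset (ℕ × ℕ × ℕ) :=
  (range (2 * c + 1) ×ˢ range (2 * c + 1) ×ˢ range (2 * c + 1)).filter
    fun ijk => ijk.1 + ijk.2.1 + ijk.2.2 = 2 * c

/-- Membership in the index set of the constituent tensors. [cite: VassilevskaWilliamsXuXuZhou2024, §3.7] -/
theorem mem_constituentTriples {i j k : ℕ} :
    (i, j, k) ∈ constituentTriples c ↔ i + j + k = 2 * c := by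
  simp only [constituentTriples, mem_filter, mem_product, mem_range]
  constructor
  · exact fun h => h.2
  · intro h; exact ⟨⟨by omega, by omega, by omega⟩, h⟩

/-- **`T^{(ℓ)} = CW_q^{⊗c} = ∑_{i+j+k = 2c} T_{i,j,k}`** (§3.7, the displayed decomposition), entrywise.
[cite: VassilevskaWilliamsXuXuZhou2024, §3.7] -/
theorem kroneckerPow_bigCw_eq_sum_cwConstituent (x y z : Fin c → Fin (q + 2)) :
    kroneckerPow (bigCwTensor K q) c x y z =
      ∑ ijk ∈ constituentTriples c, cwConstituent K q c ijk.1 ijk.2.1 ijk.2.2 x y z := by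
  by_cases hmem :
      (∑ p, cwLevel (x p), ∑ p, cwLevel (y p), ∑ p, cwLevel (z p)) ∈ constituentTriples c
  · rw [sum_eq_single_of_mem _ hmem]
    · simp [cwConstituent_apply]
    · rintro ⟨i, j, k⟩ _ hne
      rw [cwConstituent_apply, if_neg]
      rintro ⟨h1, h2, h3⟩
      apply hne
      simp only at h1 h2 h3
      rw [h1, h2, h3]
  · have hzero : kroneckerPow (bigCwTensor K q) c x y z = 0 := by
      by_contra hne
      exact hmem ((mem_constituentTriples c).2 (sum_cwLevel_of_kroneckerPow_bigCw_ne_zero K q c hne))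
    rw [hzero]
    symm
    refine sum_eq_zero ?_
    rintro ⟨i, j, k⟩ hijk
    rw [cwConstituent_apply]
    split_ifs with hx
    · exact hzero
    · rfl

end Constituent

/-! ## Interface tensors (Def. 3.6, Def. 4.1) -/

section Interface

/-- **The data of one term of an interface tensor** (Def. 4.1): the level-`ℓ` constituent tensor
`T_{i,j,k}` and the three complete split distributions `γ_X, γ_Y, γ_Z`; the exponent `n_t` of the
term is carried by the term map (see `interfaceTensor`).  Def. 4.1 requires `i + j + k = 2^ℓ`
(`= 2c`) and the `γ`'s to be distributions; neither is imposed here — a term (with `n_t ≥ 1`)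
violating the first is zero (`cwConstituent_eq_zero`), and a `γ` that is not the type of a word of
chunks on `τ⁻¹(t) ≠ ∅` keeps no level-1 block at tolerance `ε = 0`. [cite: VassilevskaWilliamsXuXuZhou2024, Def. 4.1] -/
structure InterfaceTerm (c : ℕ) where
  /-- level-`ℓ` `X`-block index `i` -/
  i : ℕ
  /-- level-`ℓ` `Y`-block index `j` -/
  j : ℕ
  /-- level-`ℓ` `Z`-block index `k` -/
  k : ℕ
  /-- complete split distribution for the `X`-blocks -/
  γX : (Fin c → Fin 3) → ℝ
  /-- complete split distribution for the `Y`-blocks -/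
  γY : (Fin c → Fin 3) → ℝ
  /-- complete split distribution for the `Z`-blocks -/
  γZ : (Fin c → Fin 3) → ℝ

variable {c n s : ℕ}

/-- **Admissible level-1 sequences in one dimension**: chunk `u` lies in the level-`ℓ` block
`deg (τ u)` of its term, and on the chunk set `τ⁻¹(t)` of every term `t` that HAS chunks the complete
split distribution is `ε`-consistent with `γ t` (the level-1 blocks kept by Def. 3.6 in each term of
Def. 4.1).  A term without chunks (`n_t = |τ⁻¹(t)| = 0`, the factor `T^{⊗0}[…] ≅ ⟨1⟩` of Def. 4.1)
imposes no condition, as in the paper, where it is the trivial factor of the tensor product.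
[cite: VassilevskaWilliamsXuXuZhou2024, Def. 3.6 and Def. 4.1] -/
def admissibleSeqs (τ : Fin n → Fin s) (deg : Fin s → ℕ) (γ : Fin s → (Fin c → Fin 3) → ℝ) (ε : ℝ) :
    Finset (Fin n → Fin c → Fin 3) := by
  classical
  exact univ.filter fun I => (∀ u, patternLevel (I u) = deg (τ u)) ∧
    ∀ t, (univ.filter fun u => τ u = t).Nonempty → SplitConsistentOn ε (γ t) I (univ.filter fun u => τ u = t)

/-- Membership in the admissible level-1 sequences. [cite: VassilevskaWilliamsXuXuZhou2024, Def. 3.6 and Def. 4.1] -/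
theorem mem_admissibleSeqs {τ : Fin n → Fin s} {deg : Fin s → ℕ} {γ : Fin s → (Fin c → Fin 3) → ℝ}
    {ε : ℝ} {I : Fin n → Fin c → Fin 3} :
    I ∈ admissibleSeqs τ deg γ ε ↔ (∀ u, patternLevel (I u) = deg (τ u)) ∧
      ∀ t, (univ.filter fun u => τ u = t).Nonempty →
        SplitConsistentOn ε (γ t) I (univ.filter fun u => τ u = t) := by
  classical
  simp only [admissibleSeqs, mem_filter, mem_univ, true_and]

/-- For a SURJECTIVE term map (every term has a chunk, `n_t ≥ 1`) admissibility is the conjunction of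
the level condition and consistency on every term, without the non-emptiness guard.
[cite: VassilevskaWilliamsXuXuZhou2024, Def. 4.1] -/
theorem mem_admissibleSeqs_of_surjective {τ : Fin n → Fin s} (hτ : Function.Surjective τ) {deg : Fin s → ℕ}
    {γ : Fin s → (Fin c → Fin 3) → ℝ} {ε : ℝ} {I : Fin n → Fin c → Fin 3} :
    I ∈ admissibleSeqs τ deg γ ε ↔ (∀ u, patternLevel (I u) = deg (τ u)) ∧
      ∀ t, SplitConsistentOn ε (γ t) I (univ.filter fun u => τ u = t) := by
  rw [mem_admissibleSeqs]
  refine and_congr Iff.rfl (forall_congr' fun t => ?_)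
  have hne : (univ.filter fun u => τ u = t).Nonempty := by
    obtain ⟨u, hu⟩ := hτ t
    exact ⟨u, by simp [hu]⟩
  exact ⟨fun h => h hne, fun h _ => h⟩

/-- The admissible sequences grow with the tolerance. [cite: VassilevskaWilliamsXuXuZhou2024, Def. 3.6] -/
theorem admissibleSeqs_mono {τ : Fin n → Fin s} {deg : Fin s → ℕ} {γ : Fin s → (Fin c → Fin 3) → ℝ}
    {ε ε' : ℝ} (h : ε ≤ ε') : admissibleSeqs τ deg γ ε ⊆ admissibleSeqs τ deg γ ε' := by
  intro I hI
  rw [mem_admissibleSeqs] at hI ⊢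
  exact ⟨hI.1, fun t ht => (hI.2 t ht).mono h⟩

/-- **The level-1 `X`-blocks of an interface tensor** (as level-1 index sequences).
[cite: VassilevskaWilliamsXuXuZhou2024, Def. 4.1] -/
def levelBlocksX (τ : Fin n → Fin s) (L : Fin s → InterfaceTerm c) (ε : ℝ) :
    Finset (Fin n → Fin c → Fin 3) :=
  admissibleSeqs τ (fun t => (L t).i) (fun t => (L t).γX) ε

/-- **The level-1 `Y`-blocks of an interface tensor.** [cite: VassilevskaWilliamsXuXuZhou2024, Def. 4.1] -/
def levelBlocksY (τ : Fin n → Fin s) (L : Fin s → InterfaceTerm c) (ε : ℝ) :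
    Finset (Fin n → Fin c → Fin 3) :=
  admissibleSeqs τ (fun t => (L t).j) (fun t => (L t).γY) ε

/-- **The level-1 `Z`-blocks of an interface tensor.** [cite: VassilevskaWilliamsXuXuZhou2024, Def. 4.1] -/
def levelBlocksZ (τ : Fin n → Fin s) (L : Fin s → InterfaceTerm c) (ε : ℝ) :
    Finset (Fin n → Fin c → Fin 3) :=
  admissibleSeqs τ (fun t => (L t).k) (fun t => (L t).γZ) ε

variable (K : Type u) [CommSemiring K] (q : ℕ)

/-- **The level-`ℓ` `ε`-interface tensor with parameter list `(τ, L)`** (Def. 4.1, through Def. 3.6):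
`⊗_{t ∈ [s]} T_{i_t, j_t, k_t}^{⊗ n_t}[γ_X^{(t)}, γ_Y^{(t)}, γ_Z^{(t)}, ε]`, realised on the concatenated
chunk set `[n] = ⊔_t τ⁻¹(t)` as the zero-out of `(CW_q^{⊗c})^{⊗n}` keeping the variables whose level-1
sequences are admissible (`levelBlocksX/Y/Z`).  `ε = 0`: a level-`ℓ` interface tensor.
[cite: VassilevskaWilliamsXuXuZhou2024, Def. 4.1] -/
def interfaceTensor (τ : Fin n → Fin s) (L : Fin s → InterfaceTerm c) (ε : ℝ) :
    (Fin n → Fin c → Fin (q + 2)) → (Fin n → Fin c → Fin (q + 2)) → (Fin n → Fin c → Fin (q + 2)) → K :=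
  partSubtensor levelSeq levelSeq levelSeq (kroneckerPow (kroneckerPow (bigCwTensor K q) c) n)
    (levelBlocksX τ L ε) (levelBlocksY τ L ε) (levelBlocksZ τ L ε)

/-- **Def. 3.6, `T_{i,j,k}^{⊗N}[γ_X, γ_Y, γ_Z, ε]`**: the one-term interface tensor — the sub-tensor of
`T_{i,j,k}^{⊗N}` over the level-1 triples `X_Î Y_Ĵ Z_K̂` with `Î, Ĵ, K̂` approximately consistent with
`γ_X, γ_Y, γ_Z`. [cite: VassilevskaWilliamsXuXuZhou2024, Def. 3.6] -/
def cwSplitTerm (T : InterfaceTerm c) (ε : ℝ) :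
    (Fin n → Fin c → Fin (q + 2)) → (Fin n → Fin c → Fin (q + 2)) → (Fin n → Fin c → Fin (q + 2)) → K :=
  interfaceTensor K q (fun _ : Fin n => (0 : Fin 1)) (fun _ => T) ε

/-- Entries of an interface tensor: the entries `∏_{u,p} CW_q(x_{u,p}, y_{u,p}, z_{u,p})` of
`CW_q^{⊗cn}` on admissible triples of variables, `0` elsewhere. [cite: VassilevskaWilliamsXuXuZhou2024, Def. 4.1] -/
theorem interfaceTensor_apply (τ : Fin n → Fin s) (L : Fin s → InterfaceTerm c) (ε : ℝ)
    (x y z : Fin n → Fin c → Fin (q + 2)) :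
    interfaceTensor K q τ L ε x y z =
      if levelSeq x ∈ levelBlocksX τ L ε ∧ levelSeq y ∈ levelBlocksY τ L ε ∧
          levelSeq z ∈ levelBlocksZ τ L ε then
        ∏ u, ∏ p, bigCwTensor K q (x u p) (y u p) (z u p) else 0 := by
  simp [interfaceTensor, partSubtensor_apply, kroneckerPow_apply]

/-- The entries of an interface tensor are products over the chunks of entries of the constituent
tensors of the terms: `𝒯(x,y,z) = ∏_u T_{i_{τu}, j_{τu}, k_{τu}}(x_u, y_u, z_u)` on admissible
triples (Def. 4.1 read literally: `𝒯 = ⊗_t T_{i_t,j_t,k_t}^{⊗n_t}[…]`). [cite: VassilevskaWilliamsXuXuZhou2024, Def. 4.1] -/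
theorem interfaceTensor_apply_prod (τ : Fin n → Fin s) (L : Fin s → InterfaceTerm c) (ε : ℝ)
    (x y z : Fin n → Fin c → Fin (q + 2)) :
    interfaceTensor K q τ L ε x y z =
      if levelSeq x ∈ levelBlocksX τ L ε ∧ levelSeq y ∈ levelBlocksY τ L ε ∧
          levelSeq z ∈ levelBlocksZ τ L ε then
        ∏ u, cwConstituent K q c (L (τ u)).i (L (τ u)).j (L (τ u)).k (x u) (y u) (z u) else 0 := by
  rw [interfaceTensor_apply]
  split_ifs with h
  · obtain ⟨hx, hy, hz⟩ := h
    refine prod_congr rfl fun u _ => ?_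
    have hxu := ((mem_admissibleSeqs.1 hx).1 u)
    have hyu := ((mem_admissibleSeqs.1 hy).1 u)
    have hzu := ((mem_admissibleSeqs.1 hz).1 u)
    rw [patternLevel_levelSeq] at hxu hyu hzu
    rw [cwConstituent_apply, if_pos ⟨hxu, hyu, hzu⟩, kroneckerPow_apply]
  · rfl

/-- An interface tensor vanishes outside its level-1 blocks. [cite: VassilevskaWilliamsXuXuZhou2024, Def. 4.1] -/
theorem interfaceTensor_ne_zero {τ : Fin n → Fin s} {L : Fin s → InterfaceTerm c} {ε : ℝ}
    {x y z : Fin n → Fin c → Fin (q + 2)} (h : interfaceTensor K q τ L ε x y z ≠ 0) :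
    levelSeq x ∈ levelBlocksX τ L ε ∧ levelSeq y ∈ levelBlocksY τ L ε ∧
      levelSeq z ∈ levelBlocksZ τ L ε := by
  rw [interfaceTensor_apply] at h
  by_contra hc
  exact h (if_neg hc)

/-- `(CW_q^{⊗c})^{⊗n} ≥ 𝒯`: an interface tensor is a zero-out of the power. [cite: VassilevskaWilliamsXuXuZhou2024, Def. 4.1 and §3.3] -/
theorem tensorRestrictsTo_interfaceTensor (τ : Fin n → Fin s) (L : Fin s → InterfaceTerm c) (ε : ℝ) :
    TensorRestrictsTo (kroneckerPow (kroneckerPow (bigCwTensor K q) c) n) (interfaceTensor K q τ L ε) :=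
  tensorRestrictsTo_partSubtensor _ _ _ _ _ _ _

/-- `CW_q^{⊗N} ≥ 𝒯` for `N = n c`: through the re-indexing `CW_q^{⊗ nc} ≥ (CW_q^{⊗c})^{⊗n}` (§3.8:
"we set `N := n · 2^{ℓ-1}`" and view `CW_q^{⊗N}` as `(T^{(ℓ)})^{⊗n}`). [cite: VassilevskaWilliamsXuXuZhou2024, §3.8 and Def. 4.1] -/
theorem tensorRestrictsTo_kroneckerPow_interfaceTensor (τ : Fin n → Fin s) (L : Fin s → InterfaceTerm c)
    (ε : ℝ) : TensorRestrictsTo (kroneckerPow (bigCwTensor K q) (n * c)) (interfaceTensor K q τ L ε) :=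
  (Literature.Barriers.MatrixMultiplication.tensorRestrictsTo_kroneckerPow_mul (bigCwTensor K q) n c).trans
    (tensorRestrictsTo_interfaceTensor K q τ L ε)

/-- The level-1 `X`-blocks grow with the tolerance `ε`. [cite: VassilevskaWilliamsXuXuZhou2024, Def. 3.6] -/
theorem levelBlocksX_mono (τ : Fin n → Fin s) (L : Fin s → InterfaceTerm c) {ε ε' : ℝ} (h : ε ≤ ε') :
    levelBlocksX τ L ε ⊆ levelBlocksX τ L ε' :=
  admissibleSeqs_mono h

/-- The level-1 `Y`-blocks grow with the tolerance `ε`. [cite: VassilevskaWilliamsXuXuZhou2024, Def. 3.6] -/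
theorem levelBlocksY_mono (τ : Fin n → Fin s) (L : Fin s → InterfaceTerm c) {ε ε' : ℝ} (h : ε ≤ ε') :
    levelBlocksY τ L ε ⊆ levelBlocksY τ L ε' :=
  admissibleSeqs_mono h

/-- The level-1 `Z`-blocks grow with the tolerance `ε`. [cite: VassilevskaWilliamsXuXuZhou2024, Def. 3.6] -/
theorem levelBlocksZ_mono (τ : Fin n → Fin s) (L : Fin s → InterfaceTerm c) {ε ε' : ℝ} (h : ε ≤ ε') :
    levelBlocksZ τ L ε ⊆ levelBlocksZ τ L ε' :=
  admissibleSeqs_mono h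

/-- An `ε'`-interface tensor restricts (by zeroing out) to the `ε`-interface tensor with the same
parameters for `ε ≤ ε'`; in particular to the exact (`ε = 0`) one. [cite: VassilevskaWilliamsXuXuZhou2024, Def. 3.6 and Def. 4.1] -/
theorem interfaceTensor_mono (τ : Fin n → Fin s) (L : Fin s → InterfaceTerm c) {ε ε' : ℝ} (h : ε ≤ ε') :
    TensorRestrictsTo (interfaceTensor K q τ L ε') (interfaceTensor K q τ L ε) := by
  have key : interfaceTensor K q τ L ε = partSubtensor levelSeq levelSeq levelSeq
      (interfaceTensor K q τ L ε') (levelBlocksX τ L ε) (levelBlocksY τ L ε) (levelBlocksZ τ L ε) := by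
    rw [interfaceTensor, interfaceTensor, partSubtensor_partSubtensor,
      inter_eq_right.2 (levelBlocksX_mono τ L h), inter_eq_right.2 (levelBlocksY_mono τ L h),
      inter_eq_right.2 (levelBlocksZ_mono τ L h)]
  rw [key]
  exact tensorRestrictsTo_partSubtensor _ _ _ _ _ _ _

end Interface

/-! ## The symmetries of an interface tensor (Property 7.1; proof of Cor. 4.2) -/

section Symmetry

variable {c n s : ℕ}

/-- **The chunk symmetries of a term map**: the permutations of the `n` chunks mapping every chunk to a
chunk of the same term (`≅ 𝓗 = S_{n_1} × ⋯ × S_{n_s}`, "randomly permute chunks within the same term").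
[cite: VassilevskaWilliamsXuXuZhou2024, §7 (proof of Cor. 4.2)] -/
def chunkSymmetries (τ : Fin n → Fin s) : Subgroup (Equiv.Perm (Fin n)) where
  carrier := {σ | ∀ u, τ (σ u) = τ u}
  mul_mem' := by
    intro a b ha hb u
    rw [Equiv.Perm.mul_apply, ha, hb]
  one_mem' := by intro u; simp
  inv_mem' := by
    intro a ha u
    calc τ (a⁻¹ u) = τ (a (a⁻¹ u)) := (ha _).symm
      _ = τ u := by simp

/-- Membership in the chunk symmetries. [cite: VassilevskaWilliamsXuXuZhou2024, §7 (proof of Cor. 4.2)] -/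
theorem mem_chunkSymmetries {τ : Fin n → Fin s} {σ : Equiv.Perm (Fin n)} :
    σ ∈ chunkSymmetries τ ↔ ∀ u, τ (σ u) = τ u := Iff.rfl

/-- Membership in the chunk symmetries is decidable (so that they form a `Fintype`). [folklore] -/
instance chunkSymmetries.decidableMem (τ : Fin n → Fin s) : DecidablePred (· ∈ chunkSymmetries τ) :=
  fun _ => decidable_of_iff _ mem_chunkSymmetries.symm

/-- A chunk symmetry stabilises the chunk set `τ⁻¹(t)` of every term. [cite: VassilevskaWilliamsXuXuZhou2024, §7 (proof of Cor. 4.2)] -/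
theorem symm_mem_fibre_iff {τ : Fin n → Fin s} {σ : Equiv.Perm (Fin n)} (hσ : σ ∈ chunkSymmetries τ)
    (t : Fin s) (u : Fin n) :
    σ u ∈ (univ.filter fun v => τ v = t) ↔ u ∈ (univ.filter fun v => τ v = t) := by
  simp [mem_chunkSymmetries.1 hσ u]

/-- Admissibility of level-1 sequences is invariant under the chunk symmetries (for every `ε`).
[cite: VassilevskaWilliamsXuXuZhou2024, §7 (proof of Cor. 4.2: "𝒢 is well-defined")] -/
theorem chunkPerm_mem_admissibleSeqs {τ : Fin n → Fin s} {σ : Equiv.Perm (Fin n)}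
    (hσ : σ ∈ chunkSymmetries τ) (deg : Fin s → ℕ) (γ : Fin s → (Fin c → Fin 3) → ℝ) (ε : ℝ)
    {I : Fin n → Fin c → Fin 3} (hI : I ∈ admissibleSeqs τ deg γ ε) :
    chunkPerm σ I ∈ admissibleSeqs τ deg γ ε := by
  rw [mem_admissibleSeqs] at hI ⊢
  refine ⟨fun u => ?_, fun t => ?_⟩
  · have h := hI.1 (σ.symm u)
    have hτ : τ (σ.symm u) = τ u := by
      have := mem_chunkSymmetries.1 ((chunkSymmetries τ).inv_mem hσ) u
      simpa [Equiv.Perm.inv_def] using this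
    simpa [hτ] using h
  · intro ht
    exact (splitConsistentOn_chunkPerm_iff σ (symm_mem_fibre_iff hσ t) ε (γ t) I).2 (hI.2 t ht)

/-- Admissibility is invariant under the chunk symmetries (iff form). [cite: VassilevskaWilliamsXuXuZhou2024, §7 (proof of Cor. 4.2)] -/
theorem chunkPerm_mem_admissibleSeqs_iff {τ : Fin n → Fin s} {σ : Equiv.Perm (Fin n)}
    (hσ : σ ∈ chunkSymmetries τ) (deg : Fin s → ℕ) (γ : Fin s → (Fin c → Fin 3) → ℝ) (ε : ℝ)
    (I : Fin n → Fin c → Fin 3) :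
    chunkPerm σ I ∈ admissibleSeqs τ deg γ ε ↔ I ∈ admissibleSeqs τ deg γ ε := by
  refine ⟨fun h => ?_, chunkPerm_mem_admissibleSeqs hσ deg γ ε⟩
  have h' := chunkPerm_mem_admissibleSeqs ((chunkSymmetries τ).inv_mem hσ) deg γ ε h
  rwa [chunkPerm_inv, Equiv.Perm.inv_def, Equiv.symm_apply_apply] at h'

variable (K : Type u) [CommSemiring K] (q : ℕ)

/-- Parts go to parts: `levelSeq (σ · x) = σ · levelSeq x` (Property 7.1, first item).
[cite: VassilevskaWilliamsXuXuZhou2024, Property 7.1 (1)] -/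
theorem levelSeq_chunkPerm (σ : Equiv.Perm (Fin n)) (x : Fin n → Fin c → Fin (q + 2)) :
    levelSeq (chunkPerm σ x) = chunkPerm σ (levelSeq x) := rfl

/-- Tensor powers are invariant under permutations of the factors. [folklore] -/
theorem kroneckerPow_chunkPerm {ι κ μ : Type*} (T : ι → κ → μ → K) (σ : Equiv.Perm (Fin n))
    (x : Fin n → ι) (y : Fin n → κ) (z : Fin n → μ) :
    kroneckerPow T n (chunkPerm σ x) (chunkPerm σ y) (chunkPerm σ z) = kroneckerPow T n x y z := by
  simp only [kroneckerPow_apply, chunkPerm_apply]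
  exact Fintype.prod_equiv σ.symm _ _ fun _ => rfl

/-- **The interface tensor is preserved by its chunk symmetries** (Property 7.1, second item).
[cite: VassilevskaWilliamsXuXuZhou2024, Property 7.1 (2) and proof of Cor. 4.2] -/
theorem interfaceTensor_chunkPerm {τ : Fin n → Fin s} (L : Fin s → InterfaceTerm c) (ε : ℝ)
    {σ : Equiv.Perm (Fin n)} (hσ : σ ∈ chunkSymmetries τ) (x y z : Fin n → Fin c → Fin (q + 2)) :
    interfaceTensor K q τ L ε (chunkPerm σ x) (chunkPerm σ y) (chunkPerm σ z) =
      interfaceTensor K q τ L ε x y z := by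
  simp only [interfaceTensor, partSubtensor_apply, levelSeq_chunkPerm, levelBlocksX, levelBlocksY,
    levelBlocksZ, chunkPerm_mem_admissibleSeqs_iff hσ, kroneckerPow_chunkPerm]

/-- **Transitivity**: two level-1 sequences admissible with `ε = 0` have, on the chunk set of every
term, the same number of chunks of each shape, hence differ by a chunk symmetry
("(item:uniform) holds due to the symmetry of the chunks within the same term").
[cite: VassilevskaWilliamsXuXuZhou2024, §7 (proof of Cor. 4.2)] -/
theorem exists_chunkSymm_apply_eq {τ : Fin n → Fin s} {deg : Fin s → ℕ}
    {γ : Fin s → (Fin c → Fin 3) → ℝ} {I I' : Fin n → Fin c → Fin 3}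
    (hI : I ∈ admissibleSeqs τ deg γ 0) (hI' : I' ∈ admissibleSeqs τ deg γ 0) :
    ∃ σ ∈ chunkSymmetries τ, chunkPerm σ I = I' := by
  classical
  -- equal restricted counts, term by term
  have hcount : ∀ (t : Fin s) (a : Fin c → Fin 3),
      ((univ.filter fun u => τ u = t).filter fun u => I u = a).card =
        ((univ.filter fun u => τ u = t).filter fun u => I' u = a).card := by
    intro t a
    set S := (univ.filter fun u => τ u = t) with hS
    rcases S.eq_empty_or_nonempty with hSe | hne
    · simp [hSe]
    · have h1 := (splitConsistentOn_zero_iff.1 ((mem_admissibleSeqs.1 hI).2 t hne))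
      have h2 := (splitConsistentOn_zero_iff.1 ((mem_admissibleSeqs.1 hI').2 t hne))
      have h12 : completeSplitOn I S a = completeSplitOn I' S a := by rw [h1, h2]
      simp only [completeSplitOn] at h12
      have hc : (S.card : ℝ) ≠ 0 := by exact_mod_cast hne.card_pos.ne'
      have := (div_left_inj' hc).1 h12
      exact_mod_cast this
  -- the words `u ↦ (τ u, I u)` and `u ↦ (τ u, I' u)` have the same type
  have htype : letterCount (fun u => (τ u, I u)) = letterCount (fun u => (τ u, I' u)) := by
    funext ta
    obtain ⟨t, a⟩ := ta
    simp only [letterCount_apply, Prod.mk.injEq]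
    have e1 : (univ.filter fun u => τ u = t ∧ I u = a) =
        ((univ.filter fun u => τ u = t).filter fun u => I u = a) := by
      rw [filter_filter]
    have e2 : (univ.filter fun u => τ u = t ∧ I' u = a) =
        ((univ.filter fun u => τ u = t).filter fun u => I' u = a) := by
      rw [filter_filter]
    rw [e1, e2, hcount t a]
  obtain ⟨σ, hσ⟩ := exists_perm_of_letterCount_eq htype
  -- `hσ : ∀ m, (τ (σ m), I' (σ m)) = (τ m, I m)`
  refine ⟨σ, ?_, ?_⟩
  · rw [mem_chunkSymmetries]
    intro u
    exact congrArg Prod.fst (hσ u)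
  · funext u
    have h := congrArg Prod.snd (hσ (σ.symm u))
    simpa using h.symm

/-- **Uniform fibres from transitivity** (Property 7.1, third item): if a finite group `Γ` acts on a
finite set `P` through `π` transitively, then for all `t, t'` exactly `|Γ|/|P|` elements map `t` to
`t'`. [folklore] -/
theorem card_filter_mul_card_eq_of_transitive {Γ P : Type*} [Group Γ] [Fintype Γ] [Fintype P]
    [DecidableEq P] (π : Γ → Equiv.Perm P) (hmul : ∀ a b t, π (a * b) t = π a (π b t))
    (htrans : ∀ t t' : P, ∃ g, π g t = t') (t t' : P) :
    (univ.filter fun g => π g t = t').card * Fintype.card P = Fintype.card Γ := by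
  have h1 : ∀ t₀ : P, π 1 t₀ = t₀ := fun t₀ => (π 1).injective (by rw [← hmul, one_mul])
  have hfib : ∀ t₁ : P,
      (univ.filter fun g => π g t = t₁).card = (univ.filter fun g => π g t = t).card := by
    intro t₁
    obtain ⟨g₀, hg₀⟩ := htrans t t₁
    symm
    refine card_bij (fun g _ => g₀ * g) (fun g hg => ?_) (fun a _ b _ h => mul_left_cancel h)
      (fun g' hg' => ⟨g₀⁻¹ * g', ?_, by simp⟩)
    · simp only [mem_filter, mem_univ, true_and] at hg ⊢
      rw [hmul, hg, hg₀]
    · simp only [mem_filter, mem_univ, true_and] at hg' ⊢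
      rw [hmul, hg', ← hg₀, ← hmul, inv_mul_cancel, h1]
  have hsum : ∑ t₁, (univ.filter fun g => π g t = t₁).card = Fintype.card Γ := by
    rw [← card_univ, card_eq_sum_card_fiberwise (f := fun g => π g t) (s := univ) (t := univ)
      fun _ _ => mem_univ _]
  rw [sum_congr rfl fun t₁ _ => hfib t₁, sum_const, card_univ, smul_eq_mul] at hsum
  rw [hfib t', mul_comm]
  exact hsum

end Symmetry

/-! ## Corollary 4.2: fixing holes in interface tensors -/

section FixingHoles

variable {K : Type u} [CommSemiring K]

/-- **Extension by zero**: if `T` vanishes unless `p x ∧ q y ∧ r z`, then the coordinate sub-tensor of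
`T` on these subtypes restricts back to `T` (the two are isomorphic up to zero padding). [folklore] -/
theorem tensorRestrictsTo_extend_subtype {X Y Z : Type*} [Fintype X] [Fintype Y] [Fintype Z]
    [DecidableEq X] [DecidableEq Y] [DecidableEq Z] (T : X → Y → Z → K) (p : X → Prop)
    (q : Y → Prop) (r : Z → Prop) [DecidablePred p] [DecidablePred q] [DecidablePred r]
    (h : ∀ x y z, T x y z ≠ 0 → p x ∧ q y ∧ r z) :
    TensorRestrictsTo (fun (x : {x // p x}) (y : {y // q y}) (z : {z // r z}) => T x.1 y.1 z.1) T := by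
  refine ⟨fun x x' => if x = x'.1 then 1 else 0, fun y y' => if y = y'.1 then 1 else 0,
    fun z z' => if z = z'.1 then 1 else 0, fun x y z => ?_⟩
  by_cases hT : T x y z = 0
  · rw [hT]
    symm
    refine sum_eq_zero fun x' _ => sum_eq_zero fun y' _ => sum_eq_zero fun z' _ => ?_
    by_cases hx : x = x'.1
    · by_cases hy : y = y'.1
      · by_cases hz : z = z'.1
        · rw [hx, hy, hz] at hT; simp [hT]
        · simp [hz]
      · simp [hy]
    · simp [hx]
  · obtain ⟨hx, hy, hz⟩ := h x y z hT
    rw [sum_eq_single ⟨x, hx⟩ (fun x' _ hx' => by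
          have : x ≠ x'.1 := fun e => hx' (Subtype.ext e).symm
          simp [this]) (by simp),
      sum_eq_single ⟨y, hy⟩ (fun y' _ hy' => by
          have : y ≠ y'.1 := fun e => hy' (Subtype.ext e).symm
          simp [this]) (by simp),
      sum_eq_single ⟨z, hz⟩ (fun z' _ hz' => by
          have : z ≠ z'.1 := fun e => hz' (Subtype.ext e).symm
          simp [this]) (by simp)]
    simp

variable (K) (q : ℕ) {c n s : ℕ}

/-- **VXXZ 2024, Corollary 4.2 (fixing holes in interface tensors), explicit form.**  Let
`𝒯 = interfaceTensor K q τ L 0` be a level-`ℓ` interface tensor on `n ≥ 1` chunks of length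
`c = 2^{ℓ-1} ≥ 1`, `N = c n`, with `M_X, M_Y, M_Z` level-1 `X`-, `Y`-, `Z`-blocks
(`levelBlocksW τ L 0`).  Let `𝒯_1, …, 𝒯_r` be broken copies of `𝒯` with holes `H_W(i)` (finite sets
of level-1 sequences, zeroed out) of hole fraction at most `1/(8N)`: `8 N |H_W(i)| ≤ M_W`.  If
`r ≥ 8^{3 ⌊log_{2N} 3^N⌋ + 3}` (`= 2^{O(N/log N)}`; printed: `r ≥ 2^{C_1 N/log N}`), then
`⊕_{i=1}^r 𝒯_i ≥ 𝒯`: the direct sum of the broken copies restricts to (in particular degenerates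
into) an unbroken copy of `𝒯`.  Proof: Thm. 7.2 (`vxxz2024_thm72`) for the level-1 blocks as parts and
the chunk symmetries `chunkSymmetries τ` (Property 7.1), see the module docstring.
[cite: VassilevskaWilliamsXuXuZhou2024, Cor. 4.2] -/
theorem vxxz2024_cor42 (hc : 0 < c) (hn : 0 < n) (τ : Fin n → Fin s) (L : Fin s → InterfaceTerm c)
    {r : ℕ} (HX HY HZ : Fin r → Finset (Fin n → Fin c → Fin 3))
    (hHX : ∀ i, 8 * (c * n) * (HX i).card ≤ (levelBlocksX τ L 0).card)
    (hHY : ∀ i, 8 * (c * n) * (HY i).card ≤ (levelBlocksY τ L 0).card)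
    (hHZ : ∀ i, 8 * (c * n) * (HZ i).card ≤ (levelBlocksZ τ L 0).card)
    (hr : 8 ^ (3 * Nat.log (2 * (c * n)) (3 ^ (c * n)) + 3) ≤ r) :
    TensorRestrictsTo
      (familyDirectSum fun i => partSubtensor levelSeq levelSeq levelSeq
        (interfaceTensor K q τ L 0) (HX i)ᶜ (HY i)ᶜ (HZ i)ᶜ)
      (interfaceTensor K q τ L 0) := by
  classical
  -- the blocks, the variables of `𝒯`, the part maps
  set BX := levelBlocksX τ L 0 with hBX
  set BY := levelBlocksY τ L 0 with hBY
  set BZ := levelBlocksZ τ L 0 with hBZ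
  set 𝒯 := interfaceTensor K q τ L 0 with h𝒯
  let X' := {x : Fin n → Fin c → Fin (q + 2) // levelSeq x ∈ BX}
  let Y' := {y : Fin n → Fin c → Fin (q + 2) // levelSeq y ∈ BY}
  let Z' := {z : Fin n → Fin c → Fin (q + 2) // levelSeq z ∈ BZ}
  let pX : X' → BX := fun x => ⟨levelSeq x.1, x.2⟩
  let pY : Y' → BY := fun y => ⟨levelSeq y.1, y.2⟩
  let pZ : Z' → BZ := fun z => ⟨levelSeq z.1, z.2⟩
  let T' : X' → Y' → Z' → K := fun x y z => 𝒯 x.1 y.1 z.1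
  -- the symmetries
  let Γ := ↥(chunkSymmetries τ)
  have hmemX : ∀ (g : Γ) (I : Fin n → Fin c → Fin 3), I ∈ BX ↔ chunkPerm (g : Equiv.Perm (Fin n)) I ∈ BX :=
    fun g I => (chunkPerm_mem_admissibleSeqs_iff g.2 _ _ _ I).symm
  have hmemY : ∀ (g : Γ) (I : Fin n → Fin c → Fin 3), I ∈ BY ↔ chunkPerm (g : Equiv.Perm (Fin n)) I ∈ BY :=
    fun g I => (chunkPerm_mem_admissibleSeqs_iff g.2 _ _ _ I).symm
  have hmemZ : ∀ (g : Γ) (I : Fin n → Fin c → Fin 3), I ∈ BZ ↔ chunkPerm (g : Equiv.Perm (Fin n)) I ∈ BZ :=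
    fun g I => (chunkPerm_mem_admissibleSeqs_iff g.2 _ _ _ I).symm
  let σX : Γ → Equiv.Perm X' := fun g =>
    (chunkPerm (g : Equiv.Perm (Fin n))).subtypeEquiv fun x => hmemX g (levelSeq x)
  let σY : Γ → Equiv.Perm Y' := fun g =>
    (chunkPerm (g : Equiv.Perm (Fin n))).subtypeEquiv fun y => hmemY g (levelSeq y)
  let σZ : Γ → Equiv.Perm Z' := fun g =>
    (chunkPerm (g : Equiv.Perm (Fin n))).subtypeEquiv fun z => hmemZ g (levelSeq z)
  let πX : Γ → Equiv.Perm BX := fun g =>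
    (chunkPerm (g : Equiv.Perm (Fin n))).subtypeEquiv fun I => hmemX g I
  let πY : Γ → Equiv.Perm BY := fun g =>
    (chunkPerm (g : Equiv.Perm (Fin n))).subtypeEquiv fun I => hmemY g I
  let πZ : Γ → Equiv.Perm BZ := fun g =>
    (chunkPerm (g : Equiv.Perm (Fin n))).subtypeEquiv fun I => hmemZ g I
  have hpX : ∀ g x, pX (σX g x) = πX g (pX x) := fun g x => rfl
  have hpY : ∀ g y, pY (σY g y) = πY g (pY y) := fun g y => rfl
  have hpZ : ∀ g z, pZ (σZ g z) = πZ g (pZ z) := fun g z => rfl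
  have hT : ∀ g x y z, T' (σX g x) (σY g y) (σZ g z) = T' x y z :=
    fun g x y z => interfaceTensor_chunkPerm K q L 0 g.2 x.1 y.1 z.1
  -- uniformity (Property 7.1 (3)) from transitivity
  have hmulX : ∀ (a b : Γ) (I : BX), πX (a * b) I = πX a (πX b I) := by
    intro a b I
    apply Subtype.ext
    show chunkPerm ((a * b : Γ) : Equiv.Perm (Fin n)) I.1 =
      chunkPerm (a : Equiv.Perm (Fin n)) (chunkPerm (b : Equiv.Perm (Fin n)) I.1)
    rw [Subgroup.coe_mul, chunkPerm_mul, Equiv.Perm.mul_apply]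
  have hmulY : ∀ (a b : Γ) (I : BY), πY (a * b) I = πY a (πY b I) := by
    intro a b I
    apply Subtype.ext
    show chunkPerm ((a * b : Γ) : Equiv.Perm (Fin n)) I.1 =
      chunkPerm (a : Equiv.Perm (Fin n)) (chunkPerm (b : Equiv.Perm (Fin n)) I.1)
    rw [Subgroup.coe_mul, chunkPerm_mul, Equiv.Perm.mul_apply]
  have hmulZ : ∀ (a b : Γ) (I : BZ), πZ (a * b) I = πZ a (πZ b I) := by
    intro a b I
    apply Subtype.ext
    show chunkPerm ((a * b : Γ) : Equiv.Perm (Fin n)) I.1 =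
      chunkPerm (a : Equiv.Perm (Fin n)) (chunkPerm (b : Equiv.Perm (Fin n)) I.1)
    rw [Subgroup.coe_mul, chunkPerm_mul, Equiv.Perm.mul_apply]
  have htransX : ∀ I I' : BX, ∃ g, πX g I = I' := by
    intro I I'
    obtain ⟨σ, hσ, h⟩ := exists_chunkSymm_apply_eq I.2 I'.2
    exact ⟨⟨σ, hσ⟩, Subtype.ext (by simpa [πX] using h)⟩
  have htransY : ∀ I I' : BY, ∃ g, πY g I = I' := by
    intro I I'
    obtain ⟨σ, hσ, h⟩ := exists_chunkSymm_apply_eq I.2 I'.2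
    exact ⟨⟨σ, hσ⟩, Subtype.ext (by simpa [πY] using h)⟩
  have htransZ : ∀ I I' : BZ, ∃ g, πZ g I = I' := by
    intro I I'
    obtain ⟨σ, hσ, h⟩ := exists_chunkSymm_apply_eq I.2 I'.2
    exact ⟨⟨σ, hσ⟩, Subtype.ext (by simpa [πZ] using h)⟩
  have hUX := card_filter_mul_card_eq_of_transitive πX hmulX htransX
  have hUY := card_filter_mul_card_eq_of_transitive πY hmulY htransY
  have hUZ := card_filter_mul_card_eq_of_transitive πZ hmulZ htransZ
  -- the holes, pulled back to the blocks of `𝒯`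
  let HX' : Fin r → Finset BX := fun i => univ.filter fun I => (I : Fin n → Fin c → Fin 3) ∈ HX i
  let HY' : Fin r → Finset BY := fun i => univ.filter fun I => (I : Fin n → Fin c → Fin 3) ∈ HY i
  let HZ' : Fin r → Finset BZ := fun i => univ.filter fun I => (I : Fin n → Fin c → Fin 3) ∈ HZ i
  have hcX : ∀ i, (HX' i).card ≤ (HX i).card := fun i =>
    card_le_card_of_injOn Subtype.val (fun I hI => (mem_filter.1 hI).2) (Set.injOn_of_injective Subtype.val_injective)
  have hcY : ∀ i, (HY' i).card ≤ (HY i).card := fun i =>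
    card_le_card_of_injOn Subtype.val (fun I hI => (mem_filter.1 hI).2) (Set.injOn_of_injective Subtype.val_injective)
  have hcZ : ∀ i, (HZ' i).card ≤ (HZ i).card := fun i =>
    card_le_card_of_injOn Subtype.val (fun I hI => (mem_filter.1 hI).2) (Set.injOn_of_injective Subtype.val_injective)
  have hN : 2 ≤ 2 * (c * n) := by nlinarith
  have hbX : ∀ i, 4 * (2 * (c * n)) * (HX' i).card ≤ Fintype.card BX := by
    intro i
    rw [Fintype.card_coe]
    calc 4 * (2 * (c * n)) * (HX' i).card = 8 * (c * n) * (HX' i).card := by ring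
      _ ≤ 8 * (c * n) * (HX i).card := Nat.mul_le_mul_left _ (hcX i)
      _ ≤ BX.card := hHX i
  have hbY : ∀ i, 4 * (2 * (c * n)) * (HY' i).card ≤ Fintype.card BY := by
    intro i
    rw [Fintype.card_coe]
    calc 4 * (2 * (c * n)) * (HY' i).card = 8 * (c * n) * (HY' i).card := by ring
      _ ≤ 8 * (c * n) * (HY i).card := Nat.mul_le_mul_left _ (hcY i)
      _ ≤ BY.card := hHY i
  have hbZ : ∀ i, 4 * (2 * (c * n)) * (HZ' i).card ≤ Fintype.card BZ := by
    intro i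
    rw [Fintype.card_coe]
    calc 4 * (2 * (c * n)) * (HZ' i).card = 8 * (c * n) * (HZ' i).card := by ring
      _ ≤ 8 * (c * n) * (HZ i).card := Nat.mul_le_mul_left _ (hcZ i)
      _ ≤ BZ.card := hHZ i
  -- the number of copies
  have hcard3 : ∀ B : Finset (Fin n → Fin c → Fin 3), Fintype.card ↥B ≤ 3 ^ (c * n) := by
    intro B
    rw [Fintype.card_coe]
    calc B.card ≤ (univ : Finset (Fin n → Fin c → Fin 3)).card := card_le_univ _
      _ = 3 ^ (c * n) := by
        rw [card_univ, Fintype.card_fun, Fintype.card_fun, Fintype.card_fin, Fintype.card_fin,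
          Fintype.card_fin, ← pow_mul]
  have hlog : ∀ B : Finset (Fin n → Fin c → Fin 3),
      Nat.log (2 * (c * n)) (Fintype.card ↥B) ≤ Nat.log (2 * (c * n)) (3 ^ (c * n)) :=
    fun B => Nat.log_mono_right (hcard3 B)
  have hr' : 8 ^ (Nat.log (2 * (c * n)) (Fintype.card BX) + Nat.log (2 * (c * n)) (Fintype.card BY) +
      Nat.log (2 * (c * n)) (Fintype.card BZ) + 3) ≤ r := by
    refine le_trans (Nat.pow_le_pow_right (by norm_num) ?_) hr
    have := hlog BX; have := hlog BY; have := hlog BZ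
    omega
  -- Theorem 7.2
  have h72 := vxxz2024_thm72 pX pY pZ T' σX σY σZ πX πY πZ hpX hpY hpZ hT hUX hUY hUZ hN hN hN
    HX' HY' HZ' hbX hbY hbZ hr'
  -- transport back to the full format
  have hsub : ∀ i, TensorRestrictsTo
      (partSubtensor levelSeq levelSeq levelSeq 𝒯 (HX i)ᶜ (HY i)ᶜ (HZ i)ᶜ)
      (partSubtensor pX pY pZ T' (HX' i)ᶜ (HY' i)ᶜ (HZ' i)ᶜ) := by
    intro i
    have key : partSubtensor pX pY pZ T' (HX' i)ᶜ (HY' i)ᶜ (HZ' i)ᶜ = fun x y z =>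
        partSubtensor levelSeq levelSeq levelSeq 𝒯 (HX i)ᶜ (HY i)ᶜ (HZ i)ᶜ x.1 y.1 z.1 := by
      funext x y z
      simp [partSubtensor_apply, HX', HY', HZ', pX, pY, pZ, T']
    rw [key]
    exact TensorRestrictsTo.comap _ _ _ _
  have hext : TensorRestrictsTo T' 𝒯 :=
    tensorRestrictsTo_extend_subtype 𝒯 (fun x => levelSeq x ∈ BX) (fun y => levelSeq y ∈ BY)
      (fun z => levelSeq z ∈ BZ) fun x y z h => interfaceTensor_ne_zero K q h
  exact ((familyDirectSum_mono hsub).trans h72).trans hext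

end FixingHoles

/-! ## Tensor products of interface tensors (Def. 4.1, the remark: concatenation of parameter lists) -/

section Concat

variable {c n₁ n₂ s₁ s₂ : ℕ}

/-- **Concatenation of term maps**: the chunks of the first factor keep their terms `[s₁]`, those of
the second factor are sent to the shifted terms `s₁ + [s₂]` ("the parameter list of the tensor
product is the concatenation of the parameter lists", Def. 4.1). [cite: VassilevskaWilliamsXuXuZhou2024, Def. 4.1] -/
def concatTermMap (τ₁ : Fin n₁ → Fin s₁) (τ₂ : Fin n₂ → Fin s₂) : Fin (n₁ + n₂) → Fin (s₁ + s₂) :=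
  Fin.append (fun u => Fin.castAdd s₂ (τ₁ u)) (fun u => Fin.natAdd s₁ (τ₂ u))

/-- The concatenated term map on the chunks of the first factor. [cite: VassilevskaWilliamsXuXuZhou2024, Def. 4.1] -/
@[simp] theorem concatTermMap_castAdd (τ₁ : Fin n₁ → Fin s₁) (τ₂ : Fin n₂ → Fin s₂) (u : Fin n₁) :
    concatTermMap τ₁ τ₂ (Fin.castAdd n₂ u) = Fin.castAdd s₂ (τ₁ u) := by
  simp [concatTermMap]

/-- The concatenated term map on the chunks of the second factor. [cite: VassilevskaWilliamsXuXuZhou2024, Def. 4.1] -/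
@[simp] theorem concatTermMap_natAdd (τ₁ : Fin n₁ → Fin s₁) (τ₂ : Fin n₂ → Fin s₂) (u : Fin n₂) :
    concatTermMap τ₁ τ₂ (Fin.natAdd n₁ u) = Fin.natAdd s₁ (τ₂ u) := by
  simp [concatTermMap]

/-- Post-composition commutes with `Fin.append`. [folklore] -/
theorem comp_fin_append {α β : Type*} (f : α → β) (a : Fin s₁ → α) (b : Fin s₂ → α) :
    (fun t => f (Fin.append a b t)) = Fin.append (fun t => f (a t)) (fun t => f (b t)) := by
  funext t
  refine Fin.addCases (fun i => ?_) (fun j => ?_) t <;> simp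

/-- The level-1 sequence of a concatenated variable is the concatenation of the level-1 sequences.
[cite: VassilevskaWilliamsXuXuZhou2024, Def. 4.1] -/
theorem levelSeq_append {q : ℕ} (x₁ : Fin n₁ → Fin c → Fin (q + 2)) (x₂ : Fin n₂ → Fin c → Fin (q + 2)) :
    levelSeq (Fin.append x₁ x₂) = Fin.append (levelSeq x₁) (levelSeq x₂) := by
  funext u
  refine Fin.addCases (fun i => ?_) (fun j => ?_) u
  · funext p; simp [levelSeq]
  · funext p; simp [levelSeq]

/-- Restricted complete split distributions are invariant under re-embedding the chunks.
[cite: VassilevskaWilliamsXuXuZhou2024, Def. 3.5] -/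
theorem completeSplitOn_map {m m' : ℕ} (e : Fin m ↪ Fin m') (I' : Fin m' → Fin c → Fin 3)
    (I : Fin m → Fin c → Fin 3) (h : ∀ u, I' (e u) = I u) (S : Finset (Fin m)) :
    completeSplitOn I' (S.map e) = completeSplitOn I S := by
  funext σ
  simp only [completeSplitOn, card_map]
  congr 2
  rw [filter_map, card_map]
  congr 1
  ext u
  simp [Function.comp, h u]

/-- The chunk set of a term of the first factor inside the concatenation. [cite: VassilevskaWilliamsXuXuZhou2024, Def. 4.1] -/
theorem filter_concatTermMap_castAdd (τ₁ : Fin n₁ → Fin s₁) (τ₂ : Fin n₂ → Fin s₂) (t : Fin s₁) :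
    (univ.filter fun u => concatTermMap τ₁ τ₂ u = Fin.castAdd s₂ t) =
      (univ.filter fun u => τ₁ u = t).map (Fin.castAddEmb n₂) := by
  ext u
  simp only [mem_filter, mem_univ, true_and, mem_map, Fin.castAddEmb_apply]
  refine Fin.addCases (fun i => ?_) (fun j => ?_) u
  · simp only [concatTermMap_castAdd, Fin.castAdd_inj]
    constructor
    · intro h; exact ⟨i, h, rfl⟩
    · rintro ⟨i', h, hi'⟩
      exact hi' ▸ h
  · simp only [concatTermMap_natAdd]
    constructor
    · intro h
      exact absurd (congrArg Fin.val h) (by simp [Fin.val_natAdd, Fin.val_castAdd]; omega)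
    · rintro ⟨i', _, hi'⟩
      exact absurd (congrArg Fin.val hi') (by simp [Fin.val_natAdd, Fin.val_castAdd]; omega)

/-- The chunk set of a term of the second factor inside the concatenation. [cite: VassilevskaWilliamsXuXuZhou2024, Def. 4.1] -/
theorem filter_concatTermMap_natAdd (τ₁ : Fin n₁ → Fin s₁) (τ₂ : Fin n₂ → Fin s₂) (t : Fin s₂) :
    (univ.filter fun u => concatTermMap τ₁ τ₂ u = Fin.natAdd s₁ t) =
      (univ.filter fun u => τ₂ u = t).map (Fin.natAddEmb n₁) := by
  ext u
  simp only [mem_filter, mem_univ, true_and, mem_map, Fin.natAddEmb_apply]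
  refine Fin.addCases (fun i => ?_) (fun j => ?_) u
  · simp only [concatTermMap_castAdd]
    constructor
    · intro h
      exact absurd (congrArg Fin.val h) (by simp [Fin.val_natAdd, Fin.val_castAdd]; omega)
    · rintro ⟨i', _, hi'⟩
      exact absurd (congrArg Fin.val hi') (by simp [Fin.val_natAdd, Fin.val_castAdd]; omega)
  · simp only [concatTermMap_natAdd, Fin.natAdd_inj]
    constructor
    · intro h; exact ⟨j, h, rfl⟩
    · rintro ⟨j', h, hj'⟩
      exact hj' ▸ h

/-- **Admissibility for a concatenated parameter list splits over the two factors.**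
[cite: VassilevskaWilliamsXuXuZhou2024, Def. 4.1] -/
theorem append_mem_admissibleSeqs_iff (τ₁ : Fin n₁ → Fin s₁) (τ₂ : Fin n₂ → Fin s₂)
    (d₁ : Fin s₁ → ℕ) (d₂ : Fin s₂ → ℕ) (γ₁ : Fin s₁ → (Fin c → Fin 3) → ℝ)
    (γ₂ : Fin s₂ → (Fin c → Fin 3) → ℝ) (ε : ℝ) (I₁ : Fin n₁ → Fin c → Fin 3)
    (I₂ : Fin n₂ → Fin c → Fin 3) :
    Fin.append I₁ I₂ ∈ admissibleSeqs (concatTermMap τ₁ τ₂) (Fin.append d₁ d₂) (Fin.append γ₁ γ₂) ε ↔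
      I₁ ∈ admissibleSeqs τ₁ d₁ γ₁ ε ∧ I₂ ∈ admissibleSeqs τ₂ d₂ γ₂ ε := by
  rw [mem_admissibleSeqs, mem_admissibleSeqs, mem_admissibleSeqs]
  have hlev : (∀ u, patternLevel (Fin.append I₁ I₂ u) = Fin.append d₁ d₂ (concatTermMap τ₁ τ₂ u)) ↔
      (∀ u, patternLevel (I₁ u) = d₁ (τ₁ u)) ∧ ∀ u, patternLevel (I₂ u) = d₂ (τ₂ u) := by
    rw [Fin.forall_fin_add]
    simp only [Fin.append_left, Fin.append_right, concatTermMap_castAdd, concatTermMap_natAdd]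
  have hsplit : (∀ t, (univ.filter fun u => concatTermMap τ₁ τ₂ u = t).Nonempty →
        SplitConsistentOn ε (Fin.append γ₁ γ₂ t) (Fin.append I₁ I₂)
        (univ.filter fun u => concatTermMap τ₁ τ₂ u = t)) ↔
      (∀ t, (univ.filter fun u => τ₁ u = t).Nonempty →
        SplitConsistentOn ε (γ₁ t) I₁ (univ.filter fun u => τ₁ u = t)) ∧
        ∀ t, (univ.filter fun u => τ₂ u = t).Nonempty →
          SplitConsistentOn ε (γ₂ t) I₂ (univ.filter fun u => τ₂ u = t) := by
    rw [Fin.forall_fin_add]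
    refine and_congr (forall_congr' fun t => ?_) (forall_congr' fun t => ?_)
    · rw [filter_concatTermMap_castAdd, map_nonempty, SplitConsistentOn, SplitConsistentOn,
        completeSplitOn_map (Fin.castAddEmb n₂) (Fin.append I₁ I₂) I₁ (fun u => by simp),
        Fin.append_left]
    · rw [filter_concatTermMap_natAdd, map_nonempty, SplitConsistentOn, SplitConsistentOn,
        completeSplitOn_map (Fin.natAddEmb n₁) (Fin.append I₁ I₂) I₂ (fun u => by simp),
        Fin.append_right]
  rw [hlev, hsplit]
  constructor
  · rintro ⟨⟨h1, h2⟩, h3, h4⟩; exact ⟨⟨h1, h3⟩, h2, h4⟩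
  · rintro ⟨⟨h1, h3⟩, h2, h4⟩; exact ⟨⟨h1, h2⟩, h3, h4⟩

/-- The level-1 `X`-blocks of a tensor product of interface tensors. [cite: VassilevskaWilliamsXuXuZhou2024, Def. 4.1] -/
theorem append_mem_levelBlocksX_iff (τ₁ : Fin n₁ → Fin s₁) (τ₂ : Fin n₂ → Fin s₂)
    (L₁ : Fin s₁ → InterfaceTerm c) (L₂ : Fin s₂ → InterfaceTerm c) (ε : ℝ)
    (I₁ : Fin n₁ → Fin c → Fin 3) (I₂ : Fin n₂ → Fin c → Fin 3) :
    Fin.append I₁ I₂ ∈ levelBlocksX (concatTermMap τ₁ τ₂) (Fin.append L₁ L₂) ε ↔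
      I₁ ∈ levelBlocksX τ₁ L₁ ε ∧ I₂ ∈ levelBlocksX τ₂ L₂ ε := by
  simp only [levelBlocksX]
  rw [comp_fin_append (fun T : InterfaceTerm c => T.i), comp_fin_append (fun T : InterfaceTerm c => T.γX)]
  exact append_mem_admissibleSeqs_iff τ₁ τ₂ _ _ _ _ ε I₁ I₂

/-- The level-1 `Y`-blocks of a tensor product of interface tensors. [cite: VassilevskaWilliamsXuXuZhou2024, Def. 4.1] -/
theorem append_mem_levelBlocksY_iff (τ₁ : Fin n₁ → Fin s₁) (τ₂ : Fin n₂ → Fin s₂)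
    (L₁ : Fin s₁ → InterfaceTerm c) (L₂ : Fin s₂ → InterfaceTerm c) (ε : ℝ)
    (I₁ : Fin n₁ → Fin c → Fin 3) (I₂ : Fin n₂ → Fin c → Fin 3) :
    Fin.append I₁ I₂ ∈ levelBlocksY (concatTermMap τ₁ τ₂) (Fin.append L₁ L₂) ε ↔
      I₁ ∈ levelBlocksY τ₁ L₁ ε ∧ I₂ ∈ levelBlocksY τ₂ L₂ ε := by
  simp only [levelBlocksY]
  rw [comp_fin_append (fun T : InterfaceTerm c => T.j), comp_fin_append (fun T : InterfaceTerm c => T.γY)]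
  exact append_mem_admissibleSeqs_iff τ₁ τ₂ _ _ _ _ ε I₁ I₂

/-- The level-1 `Z`-blocks of a tensor product of interface tensors. [cite: VassilevskaWilliamsXuXuZhou2024, Def. 4.1] -/
theorem append_mem_levelBlocksZ_iff (τ₁ : Fin n₁ → Fin s₁) (τ₂ : Fin n₂ → Fin s₂)
    (L₁ : Fin s₁ → InterfaceTerm c) (L₂ : Fin s₂ → InterfaceTerm c) (ε : ℝ)
    (I₁ : Fin n₁ → Fin c → Fin 3) (I₂ : Fin n₂ → Fin c → Fin 3) :
    Fin.append I₁ I₂ ∈ levelBlocksZ (concatTermMap τ₁ τ₂) (Fin.append L₁ L₂) ε ↔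
      I₁ ∈ levelBlocksZ τ₁ L₁ ε ∧ I₂ ∈ levelBlocksZ τ₂ L₂ ε := by
  simp only [levelBlocksZ]
  rw [comp_fin_append (fun T : InterfaceTerm c => T.k), comp_fin_append (fun T : InterfaceTerm c => T.γZ)]
  exact append_mem_admissibleSeqs_iff τ₁ τ₂ _ _ _ _ ε I₁ I₂

variable (K : Type u) [CommSemiring K] (q : ℕ)

/-- Tensor powers split over concatenated index sequences: `t^{⊗(n₁+n₂)}(x₁x₂, y₁y₂, z₁z₂) =
t^{⊗n₁}(x₁,y₁,z₁) · t^{⊗n₂}(x₂,y₂,z₂)`. [folklore] -/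
theorem kroneckerPow_append {ι κ μ : Type*} (t : ι → κ → μ → K) (x₁ : Fin n₁ → ι) (x₂ : Fin n₂ → ι)
    (y₁ : Fin n₁ → κ) (y₂ : Fin n₂ → κ) (z₁ : Fin n₁ → μ) (z₂ : Fin n₂ → μ) :
    kroneckerPow t (n₁ + n₂) (Fin.append x₁ x₂) (Fin.append y₁ y₂) (Fin.append z₁ z₂) =
      kroneckerPow t n₁ x₁ y₁ z₁ * kroneckerPow t n₂ x₂ y₂ z₂ := by
  simp only [kroneckerPow_apply, Fin.prod_univ_add, Fin.append_left, Fin.append_right]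

/-- **The tensor product of two `ε`-interface tensors is the `ε`-interface tensor of the concatenated
parameter list** (Def. 4.1: "the tensor product of two level-`ℓ` `ε`-interface tensors is also a
level-`ℓ` `ε`-interface tensor, whose parameter list is the concatenation of the parameter lists"),
entrywise on concatenated variables. [cite: VassilevskaWilliamsXuXuZhou2024, Def. 4.1] -/
theorem interfaceTensor_append (τ₁ : Fin n₁ → Fin s₁) (τ₂ : Fin n₂ → Fin s₂)
    (L₁ : Fin s₁ → InterfaceTerm c) (L₂ : Fin s₂ → InterfaceTerm c) (ε : ℝ)
    (x₁ y₁ z₁ : Fin n₁ → Fin c → Fin (q + 2)) (x₂ y₂ z₂ : Fin n₂ → Fin c → Fin (q + 2)) :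
    interfaceTensor K q (concatTermMap τ₁ τ₂) (Fin.append L₁ L₂) ε (Fin.append x₁ x₂) (Fin.append y₁ y₂)
        (Fin.append z₁ z₂) =
      interfaceTensor K q τ₁ L₁ ε x₁ y₁ z₁ * interfaceTensor K q τ₂ L₂ ε x₂ y₂ z₂ := by
  simp only [interfaceTensor, partSubtensor_apply, levelSeq_append, append_mem_levelBlocksX_iff,
    append_mem_levelBlocksY_iff, append_mem_levelBlocksZ_iff, kroneckerPow_append, ite_zero_mul_ite_zero]
  have e : ((levelSeq x₁ ∈ levelBlocksX τ₁ L₁ ε ∧ levelSeq x₂ ∈ levelBlocksX τ₂ L₂ ε) ∧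
        (levelSeq y₁ ∈ levelBlocksY τ₁ L₁ ε ∧ levelSeq y₂ ∈ levelBlocksY τ₂ L₂ ε) ∧
        (levelSeq z₁ ∈ levelBlocksZ τ₁ L₁ ε ∧ levelSeq z₂ ∈ levelBlocksZ τ₂ L₂ ε)) ↔
      (levelSeq x₁ ∈ levelBlocksX τ₁ L₁ ε ∧ levelSeq y₁ ∈ levelBlocksY τ₁ L₁ ε ∧
        levelSeq z₁ ∈ levelBlocksZ τ₁ L₁ ε) ∧ (levelSeq x₂ ∈ levelBlocksX τ₂ L₂ ε ∧
        levelSeq y₂ ∈ levelBlocksY τ₂ L₂ ε ∧ levelSeq z₂ ∈ levelBlocksZ τ₂ L₂ ε) :=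
    ⟨fun ⟨⟨a1, a2⟩, ⟨b1, b2⟩, ⟨c1, c2⟩⟩ => ⟨⟨a1, b1, c1⟩, ⟨a2, b2, c2⟩⟩,
      fun ⟨⟨a1, b1, c1⟩, ⟨a2, b2, c2⟩⟩ => ⟨⟨a1, a2⟩, ⟨b1, b2⟩, ⟨c1, c2⟩⟩⟩
  by_cases h : (levelSeq x₁ ∈ levelBlocksX τ₁ L₁ ε ∧ levelSeq y₁ ∈ levelBlocksY τ₁ L₁ ε ∧
      levelSeq z₁ ∈ levelBlocksZ τ₁ L₁ ε) ∧ (levelSeq x₂ ∈ levelBlocksX τ₂ L₂ ε ∧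
      levelSeq y₂ ∈ levelBlocksY τ₂ L₂ ε ∧ levelSeq z₂ ∈ levelBlocksZ τ₂ L₂ ε)
  · rw [if_pos (e.2 h), if_pos h]
  · rw [if_neg (mt e.1 h), if_neg h]

/-- Splitting a concatenated variable into its two halves. [folklore] -/
def splitChunks {α : Type*} (x : Fin (n₁ + n₂) → α) : (Fin n₁ → α) × (Fin n₂ → α) :=
  (fun u => x (Fin.castAdd n₂ u), fun u => x (Fin.natAdd n₁ u))

/-- `Fin.append` of the two halves recovers the sequence. [folklore] -/
theorem append_splitChunks {α : Type*} (x : Fin (n₁ + n₂) → α) :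
    Fin.append (splitChunks x).1 (splitChunks x).2 = x :=
  Fin.append_castAdd_natAdd

/-- The two halves of a concatenation. [folklore] -/
theorem splitChunks_append {α : Type*} (x₁ : Fin n₁ → α) (x₂ : Fin n₂ → α) :
    splitChunks (Fin.append x₁ x₂) = (x₁, x₂) := by
  ext u <;> simp [splitChunks]

/-- The interface tensor of a concatenated parameter list IS (a re-indexing of) the Kronecker product
of the two interface tensors. [cite: VassilevskaWilliamsXuXuZhou2024, Def. 4.1] -/
theorem interfaceTensor_concat_eq (τ₁ : Fin n₁ → Fin s₁) (τ₂ : Fin n₂ → Fin s₂)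
    (L₁ : Fin s₁ → InterfaceTerm c) (L₂ : Fin s₂ → InterfaceTerm c) (ε : ℝ) :
    interfaceTensor K q (concatTermMap τ₁ τ₂) (Fin.append L₁ L₂) ε = fun x y z =>
      kroneckerTensor (interfaceTensor K q τ₁ L₁ ε) (interfaceTensor K q τ₂ L₂ ε)
        (splitChunks x) (splitChunks y) (splitChunks z) := by
  funext x y z
  conv_lhs => rw [← append_splitChunks x, ← append_splitChunks y, ← append_splitChunks z]
  rw [interfaceTensor_append, kroneckerTensor_apply]

/-- Conversely the Kronecker product is a re-indexing of the interface tensor of the concatenation.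
[cite: VassilevskaWilliamsXuXuZhou2024, Def. 4.1] -/
theorem kronecker_interfaceTensor_eq (τ₁ : Fin n₁ → Fin s₁) (τ₂ : Fin n₂ → Fin s₂)
    (L₁ : Fin s₁ → InterfaceTerm c) (L₂ : Fin s₂ → InterfaceTerm c) (ε : ℝ) :
    kroneckerTensor (interfaceTensor K q τ₁ L₁ ε) (interfaceTensor K q τ₂ L₂ ε) = fun x y z =>
      interfaceTensor K q (concatTermMap τ₁ τ₂) (Fin.append L₁ L₂) ε (Fin.append x.1 x.2)
        (Fin.append y.1 y.2) (Fin.append z.1 z.2) := by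
  funext x y z
  rw [interfaceTensor_append, kroneckerTensor_apply]

/-- **`𝒯₁ ⊗ 𝒯₂ ≥ 𝒯₁₂`**: the tensor product of two interface tensors restricts to the interface
tensor of the concatenated parameter list … [cite: VassilevskaWilliamsXuXuZhou2024, Def. 4.1] -/
theorem tensorRestrictsTo_kronecker_interfaceTensor_concat (τ₁ : Fin n₁ → Fin s₁)
    (τ₂ : Fin n₂ → Fin s₂) (L₁ : Fin s₁ → InterfaceTerm c) (L₂ : Fin s₂ → InterfaceTerm c) (ε : ℝ) :
    TensorRestrictsTo (kroneckerTensor (interfaceTensor K q τ₁ L₁ ε) (interfaceTensor K q τ₂ L₂ ε))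
      (interfaceTensor K q (concatTermMap τ₁ τ₂) (Fin.append L₁ L₂) ε) := by
  rw [interfaceTensor_concat_eq]
  exact TensorRestrictsTo.comap _ _ _ _

/-- **`𝒯₁₂ ≥ 𝒯₁ ⊗ 𝒯₂`**: … and conversely, so the two are isomorphic.
[cite: VassilevskaWilliamsXuXuZhou2024, Def. 4.1] -/
theorem tensorRestrictsTo_interfaceTensor_concat_kronecker (τ₁ : Fin n₁ → Fin s₁)
    (τ₂ : Fin n₂ → Fin s₂) (L₁ : Fin s₁ → InterfaceTerm c) (L₂ : Fin s₂ → InterfaceTerm c) (ε : ℝ) :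
    TensorRestrictsTo (interfaceTensor K q (concatTermMap τ₁ τ₂) (Fin.append L₁ L₂) ε)
      (kroneckerTensor (interfaceTensor K q τ₁ L₁ ε) (interfaceTensor K q τ₂ L₂ ε)) := by
  rw [kronecker_interfaceTensor_eq]
  exact TensorRestrictsTo.comap _ _ _ _

end Concat

end Literature.Computability.AlgebraicComplexity
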